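import Literature.AnabelianGeometry.AbsoluteAnabelian.AbsTopII.DehnTwistLoopCusp
import Literature.AnabelianGeometry.AbsoluteAnabelian.AbsTopII.InertiaGroupsLogPoints
import HarnessLib

/-!
# [AbsTopII] Prop 1.3 (x) WITH A NODE, stage 1: the axis sections of `Π_I ↠ I` and the model's log points

S. Mochizuki, *Topics in Absolute Anabelian Geometry II* [AbsTopII] (bib `MochizukiAbsTopII2013`; locators =
PDF pages of the kurims manuscript `paper:url-585b8d0ad0d9`), §1, Def 1.2 (ii) p. 10, Prop 1.3 (x) p. 12:

> "(x) Let `τ_I : I → Π_I` be the [outer] homomorphism that arises [by functoriality!] from a 'log point'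
> `τ_S ∈ X^{log}(S^{log})`.  Let us call `τ_I` non-verticial (respectively, non-edge-like) if `τ_I(I)` is not
> contained in `I_v` (respectively, `I_e`) for any vertex `v` (respectively, edge `e`) of `𝔾`. [...] `τ_I` is
> non-verticial and satisfies the condition `τ_I(I) ⊆ I_{e_τ}` for some node `e_τ` of `𝔾` [and an appropriate
> choice of conjugate of `I_{e_τ}`] if and only if the image of `τ_S` is the node of `X` corresponding to `e_τ`."

MODEL/CONSTRUCTION file (class (b): defs on the lineage's own carrier `DehnTwist.Ext i = F̂₂ ⋊_{shear^i} Ẑ`; no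
instance, no notation, no `Prop` fact), abc-iut-L4-t6 lineage, row «P13x″-NODAL-LOGPOINTS» — the log points of
the DEGENERATING once-punctured genus-one curve over the log point (the nodal DPSC datum `DehnTwist.dpsc i hi` of
`DehnTwistLoopDatum.lean`: one vertex, one LOOP node `e` of `Σ`-index `i`, one cusp `c`; `Π_𝔾 = F̂₂ = ⟨a, b⟩^`,
`b` the vanishing cycle, inertia `I = Ẑ` acting by the Dehn twist `a ↦ a·b^{k^i}`).  Statement of record for
Prop 1.3 (x): `DPSCIndexData.Prop_1_3_x''` (`InertiaGroupsLogPoints.lean`, p436561) = the printed clauses for a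
FAMILY of labelled sections supplied by the model; this file supplies that family for the nodal model:

* `DehnTwist.axisSection i p hfix m : ZH →* Ext i`, `k ↦ (p(k^m), k)` — the section of `Π_I ↠ I = Ẑ` of SLOPE
  `m` along a twist-fixed axis `p : Ẑ → F̂₂` (`p = b^·` or `c^·`); slope `0` is `I_v = 1 ⋊ Ẑ` itself
  (`range_axisSection_zero`), and along `b^·` slope `i` is the conjugate `(a,1)⁻¹ I_v (a,1)` of `I_v` by the
  stable letter (`DehnTwistLoopBranchPair.mem_conjInv_smul_range_inr_iff`) — the two BRANCHES of the node;
* `DehnTwist.slopeSection i m` (axis `b^·`), `DehnTwist.cuspSlopeSection i n` (axis `c^·`, the commutator axis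
  `cAxis = Π_c` of layer L2);
* `DehnTwist.LogPt i`, `DehnTwist.logPoints i hi : LogPt i → (dpsc i hi).LogPointData` — the family: SMOOTH points
  of the component = the `Π_I`-conjugates of `I_v` (slope `0`, kind `smooth v`); the NODE's own log points = the
  conjugates of the slope-`m` sections `T_m = {(b^{k^m}, k)} ≤ I_e = b^Ẑ ⋊ Ẑ` with `0 < m < i` (kind `node e`;
  the log structure `ξ + η = i·σ` at the node, Ex 1.1 (iii) p. 9, splits as `m + (i - m)`); the CUSP's log points
  = the conjugates of `{(c^{k^n}, k)} ≤ D_c = c^Ẑ ⋊ Ẑ`, `n ≥ 1` (kind `cusp c`).  Indexed with repetitions.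
The proofs that this family satisfies `Prop_1_3_x''` — in particular that `T_m` is NON-VERTICIAL for `0 < m < i`
(so the node clause of (x) FIRES, which no smooth-curve model can show) — are the proof-only companion
`DehnTwistLoopLogPoints.lean`.
HONEST FRAMING: a constructed family on a constructed datum (constructed ≠ geometric: that these ARE the sections
`τ_I` of the log points `τ_S ∈ X^{log}(S^{log})` of the degenerate curve is the model's label — no log scheme in
the tree); typed ≠ proved; nothing here bears on [IUTchIII] Cor 3.12.
-/

noncomputable section

open scoped Pointwise

namespace Literature.AnabelianGeometry.AbsoluteAnabelian.AbsTopII.DehnTwist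

open Literature.AnabelianGeometry.EtaleTheta.SettingModel
open _root_.Topology

variable (i : ℕ)

/-! ### Axis sections of `Π_I ↠ I` -/

/-- Multiplicativity of `k ↦ (p(k^m), k)` in `Π_I = F̂₂ ⋊_{shear^i} Ẑ` for a twist-fixed axis `p` (the twist does
not see `p(k'^m)`; `Ẑ` is commutative). [cite: MochizukiAbsTopII2013, Prop 1.3 (x) p.12] -/
theorem inl_pow_mul_inr_mul (p : ZH →* F₂hatT) (hfix : ∀ k t : ZH, shearPow i k (p t) = p t) (m : ℕ) (k k' : ZH) :
    (SemidirectProduct.inl (p ((k * k') ^ m)) * SemidirectProduct.inr (k * k') : Ext i) =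
      SemidirectProduct.inl (p (k ^ m)) * SemidirectProduct.inr k *
        (SemidirectProduct.inl (p (k' ^ m)) * SemidirectProduct.inr k') := by
  have hc : Commute k k' := Literature.AnabelianGeometry.AbsoluteAnabelian.ZHatCompletion.mul_comm k k'
  refine SemidirectProduct.ext ?_ ?_
  · rw [left_inl_mul_inr, SemidirectProduct.mul_left, left_inl_mul_inr, right_inl_mul_inr, left_inl_mul_inr,
      hfix, hc.mul_pow, map_mul]
  · rw [right_inl_mul_inr, SemidirectProduct.mul_right, right_inl_mul_inr, right_inl_mul_inr]

/-- **The section of slope `m` along a twist-fixed axis**: for a homomorphism `p : Ẑ → F̂₂` whose values are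
fixed by the Dehn twist, `k ↦ (p(k^m), k)` is a homomorphism `Ẑ → Π_I = F̂₂ ⋊_{shear^i} Ẑ` splitting `Π_I ↠ I`
("`τ_I : I → Π_I`", Prop 1.3 (x)). [cite: MochizukiAbsTopII2013, Prop 1.3 (x) p.12] -/
def axisSection (p : ZH →* F₂hatT) (hfix : ∀ k t : ZH, shearPow i k (p t) = p t) (m : ℕ) : ZH →* Ext i :=
  MonoidHom.mk' (fun k => SemidirectProduct.inl (p (k ^ m)) * SemidirectProduct.inr k)
    (inl_pow_mul_inr_mul i p hfix m)

section AxisSection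

variable {i} (p : ZH →* F₂hatT) (hfix : ∀ k t : ZH, shearPow i k (p t) = p t) (m : ℕ)

/-- `axisSection p m k = (p(k^m), k)`. [cite: MochizukiAbsTopII2013, Prop 1.3 (x) p.12] -/
theorem axisSection_apply (k : ZH) :
    axisSection i p hfix m k = SemidirectProduct.inl (p (k ^ m)) * SemidirectProduct.inr k := rfl

/-- The `F̂₂`-component of `axisSection p m k` is `p(k^m)`. [cite: MochizukiAbsTopII2013, Prop 1.3 (x) p.12] -/
theorem left_axisSection (k : ZH) : (axisSection i p hfix m k).left = p (k ^ m) := left_inl_mul_inr i _ _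

/-- The `Ẑ`-component of `axisSection p m k` is `k` (it is a section of `Π_I ↠ I`).
[cite: MochizukiAbsTopII2013, Prop 1.3 (x) p.12] -/
theorem right_axisSection (k : ZH) : (axisSection i p hfix m k).right = k := right_inl_mul_inr i _ _

/-- `proj ∘ axisSection = id`: a section of `Π_I ↠ I`. [cite: MochizukiAbsTopII2013, Prop 1.3 (x) p.12] -/
theorem proj_axisSection (k : ZH) : proj i (axisSection i p hfix m k) = k := right_axisSection p hfix m k

/-- **Membership in the slope-`m` section**: `x ∈ T_m ⇔ x.left = p(x.right^m)`.
[cite: MochizukiAbsTopII2013, Prop 1.3 (x) p.12] -/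
theorem mem_range_axisSection_iff (x : Ext i) :
    x ∈ (axisSection i p hfix m).range ↔ x.left = p (x.right ^ m) := by
  constructor
  · rintro ⟨k, rfl⟩
    rw [left_axisSection, right_axisSection]
  · intro hx
    refine ⟨x.right, ?_⟩
    rw [axisSection_apply, ← hx, SemidirectProduct.inl_left_mul_inr_right]

/-- **Slope `0` is `I_v = 1 ⋊ Ẑ`** (the verticial section; `I_v = inr(Ẑ)` at the nodal datum by
`Iv_dpsc_eq_range_inr_holds`). [cite: MochizukiAbsTopII2013, Prop 1.3 (x) p.12] -/
theorem range_axisSection_zero : (axisSection i p hfix 0).range = (SemidirectProduct.inr : ZH →* Ext i).range := by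
  ext x
  rw [mem_range_axisSection_iff, pow_zero, map_one]
  constructor
  · intro hx
    refine ⟨x.right, ?_⟩
    conv_rhs => rw [← SemidirectProduct.inl_left_mul_inr_right x]
    rw [hx, map_one, one_mul]
  · rintro ⟨k, rfl⟩
    exact SemidirectProduct.left_inr k

/-- The slope-`m` section is CLOSED in `Π_I` (an equaliser of continuous maps into the Hausdorff `F̂₂`), for
continuous `p`. [cite: MochizukiAbsTopII2013, Prop 1.3 (x) p.12] -/
theorem isClosed_range_axisSection (hp : Continuous p) :
    IsClosed (((axisSection i p hfix m).range : Subgroup (Ext i)) : Set (Ext i)) := by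
  have hset : (((axisSection i p hfix m).range : Subgroup (Ext i)) : Set (Ext i)) =
      {x | x.left = p (x.right ^ m)} := Set.ext fun x => mem_range_axisSection_iff p hfix m x
  rw [hset]
  exact isClosed_eq (continuous_fst.comp (continuous_leftRight i))
    (hp.comp ((continuous_pow m).comp (continuous_snd.comp (continuous_leftRight i))))

/-- `T_m ∩ (F̂₂ × 1) = 1`: the section meets `Π_𝔾` trivially. [cite: MochizukiAbsTopII2013, Prop 1.3 (x) p.12] -/
theorem range_axisSection_inf_range_inl :
    (axisSection i p hfix m).range ⊓ (SemidirectProduct.inl : F₂hatT →* Ext i).range = ⊥ := by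
  rw [eq_bot_iff]
  intro x hx
  obtain ⟨hx, n, rfl⟩ := Subgroup.mem_inf.mp hx
  rw [mem_range_axisSection_iff, SemidirectProduct.left_inl, SemidirectProduct.right_inl, one_pow, map_one] at hx
  rw [Subgroup.mem_bot, hx, map_one]

/-- `T_m · (F̂₂ × 1) = Π_I`: the section maps onto `I`. [cite: MochizukiAbsTopII2013, Prop 1.3 (x) p.12] -/
theorem range_axisSection_sup_range_inl :
    (axisSection i p hfix m).range ⊔ (SemidirectProduct.inl : F₂hatT →* Ext i).range = ⊤ := by
  rw [eq_top_iff]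
  intro x _
  have hx : x = SemidirectProduct.inl (x.left * (p (x.right ^ m))⁻¹) * axisSection i p hfix m x.right := by
    rw [axisSection_apply, ← mul_assoc, ← map_mul, inv_mul_cancel_right, SemidirectProduct.inl_left_mul_inr_right]
  rw [hx]
  exact Subgroup.mul_mem _ (Subgroup.mem_sup_right ⟨_, rfl⟩) (Subgroup.mem_sup_left ⟨x.right, rfl⟩)

end AxisSection

/-! ### Conjugates of sections -/

section Conj

variable {i}

/-- A conjugate of a closed subgroup of `Π_I` is closed (conjugation is a homeomorphism of the compact group).
[cite: MochizukiAbsTopII2013, Def 1.2 (ii) p.10] -/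
theorem isClosed_conj_smul {T : Subgroup (Ext i)} (hT : IsClosed (T : Set (Ext i))) (γ : Ext i) :
    IsClosed ((MulAut.conj γ • T : Subgroup (Ext i)) : Set (Ext i)) := by
  rw [Subgroup.coe_pointwise_smul]
  have hc : Continuous fun x : Ext i => MulAut.conj γ • x := (continuous_const.mul continuous_id).mul continuous_const
  exact (hT.isCompact.image hc).isClosed

/-- Conjugating a section keeps it disjoint from the normal subgroup `Π_𝔾 = F̂₂ × 1`.
[cite: MochizukiAbsTopII2013, Prop 1.3 (x) p.12] -/
theorem conj_smul_inf_range_inl_eq_bot {T : Subgroup (Ext i)}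
    (hT : T ⊓ (SemidirectProduct.inl : F₂hatT →* Ext i).range = ⊥) (γ : Ext i) :
    MulAut.conj γ • T ⊓ (SemidirectProduct.inl : F₂hatT →* Ext i).range = ⊥ := by
  haveI := normal_range_inl i
  rw [← Subgroup.Normal.conj_smul_eq_self γ (SemidirectProduct.inl : F₂hatT →* Ext i).range, ← Subgroup.smul_inf,
    hT, Subgroup.smul_bot]

/-- Conjugating a section keeps it mapping onto `I`. [cite: MochizukiAbsTopII2013, Prop 1.3 (x) p.12] -/
theorem conj_smul_sup_range_inl_eq_top {T : Subgroup (Ext i)}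
    (hT : T ⊔ (SemidirectProduct.inl : F₂hatT →* Ext i).range = ⊤) (γ : Ext i) :
    MulAut.conj γ • T ⊔ (SemidirectProduct.inl : F₂hatT →* Ext i).range = ⊤ := by
  haveI := normal_range_inl i
  rw [← Subgroup.Normal.conj_smul_eq_self γ (SemidirectProduct.inl : F₂hatT →* Ext i).range, ← Subgroup.smul_sup,
    hT, Subgroup.conj_smul_eq_self_of_mem (Subgroup.mem_top γ)]

end Conj

/-! ### The two axes: `b^·` (the node) and `c^·` (the cusp) -/

/-- The Dehn twist fixes the commutator axis `c^· = Π_c` pointwise (abc-iut-f-069's `shearPow_mem_cuspGp` on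
`cuspGp = cAxis`). [cite: MochizukiAbsTopII2013, Prop 1.3 (iii) p.11] -/
theorem shearPow_cPow (k t : ZH) : shearPow i k (cPow t) = cPow t :=
  shearPow_mem_cuspGp i k (cPow t) (by rw [cuspGp_eq_cAxis]; exact cPow_mem_cAxis t)

/-- **`T_m`, the section of slope `m` along the vanishing cycle**: `k ↦ (b^{k^m}, k)`.  For `0 < m < i` these are
the sections of the NODE's own log points; `T_0 = I_v`, `T_i = (a,1)⁻¹ I_v (a,1)` are the two branches.
[cite: MochizukiAbsTopII2013, Prop 1.3 (x) p.12] -/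
def slopeSection (m : ℕ) : ZH →* Ext i := axisSection i bPow.toMonoidHom (fun k t => shearPow_bPow i k t) m

/-- **The section of slope `n` along the commutator axis**: `k ↦ (c^{k^n}, k)` (`n ≥ 1`: the cusp's log points).
[cite: MochizukiAbsTopII2013, Prop 1.3 (x) p.12] -/
def cuspSlopeSection (n : ℕ) : ZH →* Ext i := axisSection i cPow.toMonoidHom (fun k t => shearPow_cPow i k t) n

/-- `slopeSection m k = (b^{k^m}, k)`. [cite: MochizukiAbsTopII2013, Prop 1.3 (x) p.12] -/
theorem slopeSection_apply (m : ℕ) (k : ZH) :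
    slopeSection i m k = SemidirectProduct.inl (bPow (k ^ m)) * SemidirectProduct.inr k := rfl

/-- `cuspSlopeSection n k = (c^{k^n}, k)`. [cite: MochizukiAbsTopII2013, Prop 1.3 (x) p.12] -/
theorem cuspSlopeSection_apply (n : ℕ) (k : ZH) :
    cuspSlopeSection i n k = SemidirectProduct.inl (cPow (k ^ n)) * SemidirectProduct.inr k := rfl

/-- `x ∈ T_m ⇔ x.left = b^{x.right^m}`. [cite: MochizukiAbsTopII2013, Prop 1.3 (x) p.12] -/
theorem mem_range_slopeSection_iff (m : ℕ) (x : Ext i) :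
    x ∈ (slopeSection i m).range ↔ x.left = bPow (x.right ^ m) :=
  mem_range_axisSection_iff _ _ m x

/-- `x ∈ U_n ⇔ x.left = c^{x.right^n}`. [cite: MochizukiAbsTopII2013, Prop 1.3 (x) p.12] -/
theorem mem_range_cuspSlopeSection_iff (n : ℕ) (x : Ext i) :
    x ∈ (cuspSlopeSection i n).range ↔ x.left = cPow (x.right ^ n) :=
  mem_range_axisSection_iff _ _ n x

/-- **Slope `0` along `b^·` is `I_v = 1 ⋊ Ẑ`.** [cite: MochizukiAbsTopII2013, Prop 1.3 (x) p.12] -/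
theorem range_slopeSection_zero : (slopeSection i 0).range = (SemidirectProduct.inr : ZH →* Ext i).range :=
  range_axisSection_zero _ _

/-- **Slope `i` along `b^·` is the second branch `(a,1)⁻¹ · I_v · (a,1)`** (gen-7 S3b's
`mem_conjInv_smul_range_inr_iff`): the two verticial sections at the node are the slopes `0` and `i = i^Σ_e`.
[cite: MochizukiAbsTopII2013, Prop 1.3 (ii) p.11] -/
theorem range_slopeSection_self :
    (slopeSection i i).range =
      MulAut.conj (SemidirectProduct.inl (eta (FreeGroup.of 0)) : Ext i)⁻¹ •
        (SemidirectProduct.inr : ZH →* Ext i).range := by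
  ext x
  rw [mem_conjInv_smul_range_inr_iff]
  constructor
  · rintro ⟨k, rfl⟩
    exact ⟨k, rfl⟩
  · rintro ⟨k, rfl⟩
    exact ⟨k, rfl⟩

/-! ### The family of log points of the nodal model -/

/-- **Labels of the log points of the degenerate curve** (with repetitions): a conjugating element of `Π_I` and
the kind — a smooth point of the component, a log point AT THE NODE of slope `m` with `0 < m < i`, or a log point at
the cusp of slope `n ≥ 1`. [cite: MochizukiAbsTopII2013, Prop 1.3 (x) p.12] -/
inductive LogPt (i : ℕ) : Type
  /-- a smooth (non-nodal, non-cuspidal) point of the irreducible component, section `γ I_v γ⁻¹` -/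
  | smooth (γ : Ext i)
  /-- a log point mapping to the node, section `γ T_m γ⁻¹`, `0 < m < i` -/
  | node (γ : Ext i) (m : ℕ) (hm : 0 < m) (hmi : m < i)
  /-- a log point mapping to the cusp, section `γ U_n γ⁻¹`, `n ≥ 1` -/
  | cusp (γ : Ext i) (n : ℕ) (hn : 0 < n)

variable {i} in
/-- The labelled section attached to a twist-fixed continuous axis `p`, a slope `m`, a conjugator `γ` and a kind:
image `γ · T_m(p) · γ⁻¹` (closed, `∩ Π_𝔾 = 1`, `· Π_𝔾 = Π_I`). [cite: MochizukiAbsTopII2013, Prop 1.3 (x) p.12] -/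
def sectionLogPoint (hi : 0 < i) (p : ZH →ₜ* F₂hatT) (hfix : ∀ k t : ZH, shearPow i k (p t) = p t) (m : ℕ)
    (γ : Ext i) (kind : DPSCIndexData.PointKind (dpsc i hi).Vert (dpsc i hi).Node (dpsc i hi).Cusp) :
    (dpsc i hi).LogPointData where
  image := MulAut.conj γ • (axisSection i p.toMonoidHom hfix m).range
  image_le := le_top
  isClosed_image := isClosed_conj_smul (isClosed_range_axisSection p.toMonoidHom hfix m p.continuous) γ
  image_inf := conj_smul_inf_range_inl_eq_bot (range_axisSection_inf_range_inl p.toMonoidHom hfix m) γ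
  image_sup := conj_smul_sup_range_inl_eq_top (range_axisSection_sup_range_inl p.toMonoidHom hfix m) γ
  kind := kind

/-- **The log points of the nodal model** `dpsc i hi` as labelled sections (`DPSCIndexData.LogPointData`):
smooth points ↦ (`γ I_v γ⁻¹`, smooth `v`); node points ↦ (`γ T_m γ⁻¹`, node `e`), `0 < m < i`; cusp points ↦
(`γ U_n γ⁻¹`, cusp `c`), `n ≥ 1`.  The family `Prop_1_3_x''` is evaluated on (companion file).
[cite: MochizukiAbsTopII2013, Prop 1.3 (x) p.12] -/
def logPoints (hi : 0 < i) : LogPt i → (dpsc i hi).LogPointData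
  | LogPt.smooth γ => sectionLogPoint hi bPow (fun k t => shearPow_bPow i k t) 0 γ (DPSCIndexData.PointKind.smooth ⟨()⟩)
  | LogPt.node γ m _ _ => sectionLogPoint hi bPow (fun k t => shearPow_bPow i k t) m γ (DPSCIndexData.PointKind.node ⟨()⟩)
  | LogPt.cusp γ n _ => sectionLogPoint hi cPow (fun k t => shearPow_cPow i k t) n γ (DPSCIndexData.PointKind.cusp ⟨()⟩)

section Family

variable {i} (hi : 0 < i)

/-- The smooth member `γ`: image `γ I_v γ⁻¹ = γ T_0 γ⁻¹`. [cite: MochizukiAbsTopII2013, Prop 1.3 (x) p.12] -/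
theorem logPoints_smooth_image (γ : Ext i) :
    (logPoints i hi (LogPt.smooth γ)).image = MulAut.conj γ • (slopeSection i 0).range := rfl

/-- The smooth member is labelled smooth. [cite: MochizukiAbsTopII2013, Prop 1.3 (x) p.12] -/
theorem logPoints_smooth_kind (γ : Ext i) :
    (logPoints i hi (LogPt.smooth γ)).kind = DPSCIndexData.PointKind.smooth ⟨()⟩ := rfl

/-- The node member `(γ, m)`: image `γ T_m γ⁻¹`. [cite: MochizukiAbsTopII2013, Prop 1.3 (x) p.12] -/
theorem logPoints_node_image (γ : Ext i) (m : ℕ) (hm : 0 < m) (hmi : m < i) :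
    (logPoints i hi (LogPt.node γ m hm hmi)).image = MulAut.conj γ • (slopeSection i m).range := rfl

/-- The node member is labelled node. [cite: MochizukiAbsTopII2013, Prop 1.3 (x) p.12] -/
theorem logPoints_node_kind (γ : Ext i) (m : ℕ) (hm : 0 < m) (hmi : m < i) :
    (logPoints i hi (LogPt.node γ m hm hmi)).kind = DPSCIndexData.PointKind.node ⟨()⟩ := rfl

/-- The cusp member `(γ, n)`: image `γ U_n γ⁻¹`. [cite: MochizukiAbsTopII2013, Prop 1.3 (x) p.12] -/
theorem logPoints_cusp_image (γ : Ext i) (n : ℕ) (hn : 0 < n) :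
    (logPoints i hi (LogPt.cusp γ n hn)).image = MulAut.conj γ • (cuspSlopeSection i n).range := rfl

/-- The cusp member is labelled cusp. [cite: MochizukiAbsTopII2013, Prop 1.3 (x) p.12] -/
theorem logPoints_cusp_kind (γ : Ext i) (n : ℕ) (hn : 0 < n) :
    (logPoints i hi (LogPt.cusp γ n hn)).kind = DPSCIndexData.PointKind.cusp ⟨()⟩ := rfl

end Family

end Literature.AnabelianGeometry.AbsoluteAnabelian.AbsTopII.DehnTwist

end
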